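import Literature.AnabelianGeometry.EtaleTheta.GalSectCor28iiCuspTransport
import HarnessLib

/-!
# [EtTh] Cor. 2.8 (ii) — NODE CLOSER: the node's own typed declaration `TemperedCoverData.Cor28_ii`
# (the four printed cases) from the per-member END-KNIT, with the list bookkeeping discharged (proof-only)

Mochizuki, *The étale theta function and its Frobenioid-theoretic manifestations* [EtTh], Publ. RIMS **45**
(2009), Cor. 2.8 (ii) p.268 (PRIMS PDF p.42) [cite: MochizukiEtTh2009, Cor 2.8 (ii) p.42]; Prop. 2.4 p.265
(PDF p.39) for the four lists.  abc-iut cell, layer L2, block C / W6 tranche 2 row `EtTh:Cor2.8(ii)` (seat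
abc-iut-w6-d050 gen 2), sequel to abc-iut-w5-d062's `GalSectCor28iiEndKnit.lean` (p436362,
`cor28iiAt_of_equivariantFamily`) and `GalSectCor28iiCuspTransport.lean` (p439268, `…_of_tpDx`).
PROOF-ONLY: no definitions, no instances, no named facts; nothing of the typer's files is restated.

WHAT IS CLOSED.  ROW (B)'s node declaration (`GalSectCuspPairTorsors.lean`)

  `T.Cor28_ii 𝒟Xuu 𝒟Xu 𝒟Cuu 𝒟Cu :=
     T.Cor28iiAt (T.tp T.PiXuu) T.tower (2 * l) 𝒟Xuu ∧
     T.Cor28iiAt (T.tp T.PiXu) [T.tp T.PiXu, T.tp T.PiX, T.PiYddtp] 2 𝒟Xu ∧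
     T.Cor28iiAt (T.tp T.PiCuu) T.tower (2 * l) 𝒟Cuu ∧
     T.Cor28iiAt (T.tp T.PiCu) [T.tp T.PiCu, T.tp T.PiXu, T.tp T.PiX, T.PiYddtp] 2 𝒟Cu`

is the conjunction of the four printed cases `X̲̲` (`μ_{2l}`), `X̲` (`μ₂`), `C̲̲` (`μ_{2l}`), `C̲` (`μ₂`), each
with its Prop. 2.4 list.  The per-member END-KNIT `cor28iiAt_of_equivariantFamily` (p436362) reduces ONE
`Cor28iiAt S L n 𝒟` to (stab) «every automorphism `Γ` of `Π^tp_C` stabilising the list `L` stabilises the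
member `S` and `Δ^tp_C` and carries the cusp stabiliser `D_C` to a conjugate» and (fam) «an EQUIVARIANT family
`R g` of `μ_n`-sub-structures of the canonical integral structures».  Here:

* the `S`-half of (stab) is DISCHARGED: in all four cases the member is an entry of its own list
  (`tp Π_{X̲̲}, tp Π_{C̲̲} ∈ T.tower`; `tp Π_{X̲}`, `tp Π_{C̲}` head their lists);
* the remaining stabilisation input is stated ONCE, on the weakest common sub-list
  `[tp Π_{X̲}, tp Π_X, Π^tp_Ÿ]` — an entry-wise sub-list of all four printed lists — so ONE hypothesis
  `hstab` serves the four cases (`Δ^tp_C` stabilised: [AbsAnab] Lem. 1.3.8 genre; `D_C` carried to a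
  conjugate: cuspidal decomposition groups are group-theoretic, [SemiAnbd] Thm. 6.5 (iii) / [AbsTopI]
  Lem. 4.5 genre — the shapes of p436362 verbatim);
* the four equivariant families are the substantive named inputs, verbatim in the shape of p436362 (in print:
  the structures "determined by the `{±1}`-structure of Theorem 1.10, (iii)" via [GalSect] Cor. 4.12, and
  their equivariance = "preserved by `γ`").

Declarations: `tp_PiXuu_mem_tower`, `tp_PiCuu_mem_tower` (list bookkeeping); `stabilises_subList_of_tower`,
`stabilises_subList_of_listXu`, `stabilises_subList_of_listCu` (the common sub-list is stabilised in each
case); **`cor28_ii_of_equivariantFamilies`** (node closer, FQ type `TemperedCoverData.Cor28_ii …`);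
**`cor28_ii_of_equivariantFamilies_of_tpDx`** (the same with `D_C` read at the X-level through p439268's
`cuspStabC_map_eq_of_tpDx`: `Γ(tp D_x) = h·(tp D_x)·h⁻¹`).

HONEST FRAMING: [EtTh] is a refereed published paper; nothing printed is asserted here — the equivariant
families and the stabilisation data are INPUTS (hypotheses BY NAME, never constructed); typed ≠ proved; the
abc-iut cell takes no side on [IUTchIII] Cor. 3.12, on which nothing in this file bears.
-/

noncomputable section

namespace Literature.AnabelianGeometry.EtaleTheta

open scoped Pointwise

namespace ThetaCovers

namespace TemperedCoverData

universe u

variable {l : ℕ} (T : TemperedCoverData.{u} l)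

/-! ### List bookkeeping: the members are entries of their Prop. 2.4 lists -/

/-- `tp Π_{X̲̲}` is an entry of the tower list of Prop. 2.4. [cite: MochizukiEtTh2009, Prop 2.4 p.39] -/
theorem tp_PiXuu_mem_tower : T.tp T.PiXuu ∈ T.tower := by
  simp [TemperedCoverData.tower]

/-- `tp Π_{C̲̲}` is an entry of the tower list of Prop. 2.4. [cite: MochizukiEtTh2009, Prop 2.4 p.39] -/
theorem tp_PiCuu_mem_tower : T.tp T.PiCuu ∈ T.tower := by
  simp [TemperedCoverData.tower]

/-- An automorphism stabilising every entry of the tower list stabilises every entry of the common sub-list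
`[tp Π_{X̲}, tp Π_X, Π^tp_Ÿ]`. [cite: MochizukiEtTh2009, Prop 2.4 p.39] -/
theorem stabilises_subList_of_tower (Γ : T.Gtp ≃ₜ* T.Gtp)
    (hΓ : ∀ S' ∈ T.tower, S'.map Γ.toMulEquiv.toMonoidHom = S') :
    ∀ S' ∈ [T.tp T.PiXu, T.tp T.PiX, T.PiYddtp], S'.map Γ.toMulEquiv.toMonoidHom = S' := by
  intro S' hS'
  apply hΓ
  simp only [TemperedCoverData.tower, List.mem_cons, List.not_mem_nil, or_false] at hS' ⊢
  rcases hS' with rfl | rfl | rfl <;> simp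

/-- An automorphism stabilising every entry of the `X̲`-list `[tp Π_{X̲}, tp Π_X, Π^tp_Ÿ]` stabilises every
entry of the common sub-list (the lists coincide). [cite: MochizukiEtTh2009, Prop 2.4 p.39] -/
theorem stabilises_subList_of_listXu (Γ : T.Gtp ≃ₜ* T.Gtp)
    (hΓ : ∀ S' ∈ [T.tp T.PiXu, T.tp T.PiX, T.PiYddtp], S'.map Γ.toMulEquiv.toMonoidHom = S') :
    ∀ S' ∈ [T.tp T.PiXu, T.tp T.PiX, T.PiYddtp], S'.map Γ.toMulEquiv.toMonoidHom = S' :=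
  hΓ

/-- An automorphism stabilising every entry of the `C̲`-list `[tp Π_{C̲}, tp Π_{X̲}, tp Π_X, Π^tp_Ÿ]`
stabilises every entry of the common sub-list `[tp Π_{X̲}, tp Π_X, Π^tp_Ÿ]` (its tail).
[cite: MochizukiEtTh2009, Prop 2.4 p.39] -/
theorem stabilises_subList_of_listCu (Γ : T.Gtp ≃ₜ* T.Gtp)
    (hΓ : ∀ S' ∈ [T.tp T.PiCu, T.tp T.PiXu, T.tp T.PiX, T.PiYddtp], S'.map Γ.toMulEquiv.toMonoidHom = S') :
    ∀ S' ∈ [T.tp T.PiXu, T.tp T.PiX, T.PiYddtp], S'.map Γ.toMulEquiv.toMonoidHom = S' :=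
  fun S' hS' => hΓ S' (List.mem_cons_of_mem _ hS')

/-! ### The node closer -/

/-- **[EtTh] Cor. 2.8 (ii) — NODE CLOSER** for the typed four-case declaration `Cor28_ii` (cases `X̲̲`
(`μ_{2l}`), `X̲` (`μ₂`), `C̲̲` (`μ_{2l}`), `C̲` (`μ₂`), each with its Prop. 2.4 list), from:

* `hstab` — ONE stabilisation input on the common sub-list `[tp Π_{X̲}, tp Π_X, Π^tp_Ÿ]` of the four lists:
  an automorphism `Γ` of `Π^tp_C` stabilising these three entries stabilises `Δ^tp_C` ([AbsAnab] Lem. 1.3.8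
  genre) and carries the cusp stabiliser `D_C` to a conjugate `h·D_C·h⁻¹` ([SemiAnbd] Thm. 6.5 (iii) /
  [AbsTopI] Lem. 4.5 genre) — the shapes of `cor28iiAt_of_equivariantFamily` (p436362); the member-stability
  half of that theorem's input is discharged here (each member is an entry of its own list);
* for each of the four members, THE equivariant family of `μ_n`-sub-structures of the canonical integral
  structures (`R…`, `hR…`, `hReq…`, verbatim in the shape of p436362) — in print the structures
  "determined by the `{±1}`-structure of Theorem 1.10, (iii)" [cf. [GalSect] Cor. 4.12] and "preserved by `γ`".

Conclusion: the node's declaration BY NAME (fully-qualified type). [cite: MochizukiEtTh2009, Cor 2.8 (ii) p.42] -/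
theorem cor28_ii_of_equivariantFamilies {A : Type u} [Group A]
    (𝒟Xuu : T.Cor28iiData (T.tp T.PiXuu) A) (𝒟Xu : T.Cor28iiData (T.tp T.PiXu) A)
    (𝒟Cuu : T.Cor28iiData (T.tp T.PiCuu) A) (𝒟Cu : T.Cor28iiData (T.tp T.PiCu) A)
    -- the stabilisation input, once, on the common sub-list of the four Prop. 2.4 lists
    (hstab : ∀ Γ : T.Gtp ≃ₜ* T.Gtp,
      (∀ S' ∈ [T.tp T.PiXu, T.tp T.PiX, T.PiYddtp], S'.map Γ.toMulEquiv.toMonoidHom = S') →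
      T.DeltaTp.map Γ.toMulEquiv.toMonoidHom = T.DeltaTp ∧
        ∃ h : T.Gtp, T.cuspStabC.map Γ.toMulEquiv.toMonoidHom = MulAut.conj h • T.cuspStabC)
    -- case `X̲̲` (`μ_{2l}`, list `T.tower`): THE equivariant family
    (RXuu : ∀ g : T.Gtp, Set (T.cuspPairAt (T.tp T.PiXuu) g).SplittingClass)
    (hRXuu : ∀ g, (𝒟Xuu.torsor g).IsSubStructure (𝒟Xuu.mu (2 * l)) (𝒟Xuu.canonical g) (RXuu g))
    (hReqXuu : ∀ (Γ : T.Gtp ≃ₜ* T.Gtp) (g g' : T.Gtp)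
        (e : (T.cuspPairAt (T.tp T.PiXuu) g).SplittingClass →
          (T.cuspPairAt (T.tp T.PiXuu) g').SplittingClass),
      (∀ S' ∈ T.tower, S'.map Γ.toMulEquiv.toMonoidHom = S') →
      (T.cuspPairAt (T.tp T.PiXuu) g).map Γ = T.cuspPairAt (T.tp T.PiXuu) g' →
      (∀ (S₁ : Subgroup T.Gtp) (hS₁ : S₁ ∈ (T.cuspPairAt (T.tp T.PiXuu) g).splittings),
        ∃ h', e (GalSect.CuspPair.SplittingClass.mk _ S₁ hS₁) =
          GalSect.CuspPair.SplittingClass.mk _ (S₁.map Γ.toMulEquiv.toMonoidHom) h') →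
      e '' RXuu g = RXuu g')
    -- case `X̲` (`μ₂`, list `[tp Π_{X̲}, tp Π_X, Π^tp_Ÿ]`): THE equivariant family
    (RXu : ∀ g : T.Gtp, Set (T.cuspPairAt (T.tp T.PiXu) g).SplittingClass)
    (hRXu : ∀ g, (𝒟Xu.torsor g).IsSubStructure (𝒟Xu.mu 2) (𝒟Xu.canonical g) (RXu g))
    (hReqXu : ∀ (Γ : T.Gtp ≃ₜ* T.Gtp) (g g' : T.Gtp)
        (e : (T.cuspPairAt (T.tp T.PiXu) g).SplittingClass →
          (T.cuspPairAt (T.tp T.PiXu) g').SplittingClass),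
      (∀ S' ∈ [T.tp T.PiXu, T.tp T.PiX, T.PiYddtp], S'.map Γ.toMulEquiv.toMonoidHom = S') →
      (T.cuspPairAt (T.tp T.PiXu) g).map Γ = T.cuspPairAt (T.tp T.PiXu) g' →
      (∀ (S₁ : Subgroup T.Gtp) (hS₁ : S₁ ∈ (T.cuspPairAt (T.tp T.PiXu) g).splittings),
        ∃ h', e (GalSect.CuspPair.SplittingClass.mk _ S₁ hS₁) =
          GalSect.CuspPair.SplittingClass.mk _ (S₁.map Γ.toMulEquiv.toMonoidHom) h') →
      e '' RXu g = RXu g')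
    -- case `C̲̲` (`μ_{2l}`, list `T.tower`): THE equivariant family
    (RCuu : ∀ g : T.Gtp, Set (T.cuspPairAt (T.tp T.PiCuu) g).SplittingClass)
    (hRCuu : ∀ g, (𝒟Cuu.torsor g).IsSubStructure (𝒟Cuu.mu (2 * l)) (𝒟Cuu.canonical g) (RCuu g))
    (hReqCuu : ∀ (Γ : T.Gtp ≃ₜ* T.Gtp) (g g' : T.Gtp)
        (e : (T.cuspPairAt (T.tp T.PiCuu) g).SplittingClass →
          (T.cuspPairAt (T.tp T.PiCuu) g').SplittingClass),
      (∀ S' ∈ T.tower, S'.map Γ.toMulEquiv.toMonoidHom = S') →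
      (T.cuspPairAt (T.tp T.PiCuu) g).map Γ = T.cuspPairAt (T.tp T.PiCuu) g' →
      (∀ (S₁ : Subgroup T.Gtp) (hS₁ : S₁ ∈ (T.cuspPairAt (T.tp T.PiCuu) g).splittings),
        ∃ h', e (GalSect.CuspPair.SplittingClass.mk _ S₁ hS₁) =
          GalSect.CuspPair.SplittingClass.mk _ (S₁.map Γ.toMulEquiv.toMonoidHom) h') →
      e '' RCuu g = RCuu g')
    -- case `C̲` (`μ₂`, list `[tp Π_{C̲}, tp Π_{X̲}, tp Π_X, Π^tp_Ÿ]`): THE equivariant family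
    (RCu : ∀ g : T.Gtp, Set (T.cuspPairAt (T.tp T.PiCu) g).SplittingClass)
    (hRCu : ∀ g, (𝒟Cu.torsor g).IsSubStructure (𝒟Cu.mu 2) (𝒟Cu.canonical g) (RCu g))
    (hReqCu : ∀ (Γ : T.Gtp ≃ₜ* T.Gtp) (g g' : T.Gtp)
        (e : (T.cuspPairAt (T.tp T.PiCu) g).SplittingClass →
          (T.cuspPairAt (T.tp T.PiCu) g').SplittingClass),
      (∀ S' ∈ [T.tp T.PiCu, T.tp T.PiXu, T.tp T.PiX, T.PiYddtp],
        S'.map Γ.toMulEquiv.toMonoidHom = S') →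
      (T.cuspPairAt (T.tp T.PiCu) g).map Γ = T.cuspPairAt (T.tp T.PiCu) g' →
      (∀ (S₁ : Subgroup T.Gtp) (hS₁ : S₁ ∈ (T.cuspPairAt (T.tp T.PiCu) g).splittings),
        ∃ h', e (GalSect.CuspPair.SplittingClass.mk _ S₁ hS₁) =
          GalSect.CuspPair.SplittingClass.mk _ (S₁.map Γ.toMulEquiv.toMonoidHom) h') →
      e '' RCu g = RCu g') :
    Literature.AnabelianGeometry.EtaleTheta.ThetaCovers.TemperedCoverData.Cor28_ii T 𝒟Xuu 𝒟Xu 𝒟Cuu 𝒟Cu := by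
  refine ⟨?_, ?_, ?_, ?_⟩
  · -- `X̲̲`: member `tp Π_{X̲̲} ∈ T.tower`
    exact T.cor28iiAt_of_equivariantFamily (T.tp T.PiXuu) T.tower (2 * l) 𝒟Xuu
      (fun Γ hΓ => ⟨hΓ _ T.tp_PiXuu_mem_tower, hstab Γ (T.stabilises_subList_of_tower Γ hΓ)⟩)
      RXuu hRXuu hReqXuu
  · -- `X̲`: member heads its list
    exact T.cor28iiAt_of_equivariantFamily (T.tp T.PiXu) _ 2 𝒟Xu
      (fun Γ hΓ => ⟨hΓ _ List.mem_cons_self, hstab Γ hΓ⟩)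
      RXu hRXu hReqXu
  · -- `C̲̲`: member `tp Π_{C̲̲} ∈ T.tower`
    exact T.cor28iiAt_of_equivariantFamily (T.tp T.PiCuu) T.tower (2 * l) 𝒟Cuu
      (fun Γ hΓ => ⟨hΓ _ T.tp_PiCuu_mem_tower, hstab Γ (T.stabilises_subList_of_tower Γ hΓ)⟩)
      RCuu hRCuu hReqCuu
  · -- `C̲`: member heads its list
    exact T.cor28iiAt_of_equivariantFamily (T.tp T.PiCu) _ 2 𝒟Cu
      (fun Γ hΓ => ⟨hΓ _ List.mem_cons_self, hstab Γ (T.stabilises_subList_of_listCu Γ hΓ)⟩)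
      RCu hRCu hReqCu

/-- **[EtTh] Cor. 2.8 (ii) — NODE CLOSER, stabilisation read at the X-level**: as
`cor28_ii_of_equivariantFamilies`, with the cusp-stabiliser clause of `hstab` replaced by the X-level cusp
transport `Γ(tp D_x) = h·(tp D_x)·h⁻¹` (abc-iut-w5-d062's `cuspStabC_map_eq_of_tpDx`, p439268: `D_C` is
DEFINED as the normaliser of `tp D_x`, and normalisers commute with isomorphisms).
[cite: MochizukiEtTh2009, Cor 2.8 (ii) p.42] -/
theorem cor28_ii_of_equivariantFamilies_of_tpDx {A : Type u} [Group A]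
    (𝒟Xuu : T.Cor28iiData (T.tp T.PiXuu) A) (𝒟Xu : T.Cor28iiData (T.tp T.PiXu) A)
    (𝒟Cuu : T.Cor28iiData (T.tp T.PiCuu) A) (𝒟Cu : T.Cor28iiData (T.tp T.PiCu) A)
    (hstab : ∀ Γ : T.Gtp ≃ₜ* T.Gtp,
      (∀ S' ∈ [T.tp T.PiXu, T.tp T.PiX, T.PiYddtp], S'.map Γ.toMulEquiv.toMonoidHom = S') →
      T.DeltaTp.map Γ.toMulEquiv.toMonoidHom = T.DeltaTp ∧
        ∃ h : T.Gtp, (T.tp T.Dx).map Γ.toMulEquiv.toMonoidHom = MulAut.conj h • T.tp T.Dx)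
    (RXuu : ∀ g : T.Gtp, Set (T.cuspPairAt (T.tp T.PiXuu) g).SplittingClass)
    (hRXuu : ∀ g, (𝒟Xuu.torsor g).IsSubStructure (𝒟Xuu.mu (2 * l)) (𝒟Xuu.canonical g) (RXuu g))
    (hReqXuu : ∀ (Γ : T.Gtp ≃ₜ* T.Gtp) (g g' : T.Gtp)
        (e : (T.cuspPairAt (T.tp T.PiXuu) g).SplittingClass →
          (T.cuspPairAt (T.tp T.PiXuu) g').SplittingClass),
      (∀ S' ∈ T.tower, S'.map Γ.toMulEquiv.toMonoidHom = S') →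
      (T.cuspPairAt (T.tp T.PiXuu) g).map Γ = T.cuspPairAt (T.tp T.PiXuu) g' →
      (∀ (S₁ : Subgroup T.Gtp) (hS₁ : S₁ ∈ (T.cuspPairAt (T.tp T.PiXuu) g).splittings),
        ∃ h', e (GalSect.CuspPair.SplittingClass.mk _ S₁ hS₁) =
          GalSect.CuspPair.SplittingClass.mk _ (S₁.map Γ.toMulEquiv.toMonoidHom) h') →
      e '' RXuu g = RXuu g')
    (RXu : ∀ g : T.Gtp, Set (T.cuspPairAt (T.tp T.PiXu) g).SplittingClass)
    (hRXu : ∀ g, (𝒟Xu.torsor g).IsSubStructure (𝒟Xu.mu 2) (𝒟Xu.canonical g) (RXu g))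
    (hReqXu : ∀ (Γ : T.Gtp ≃ₜ* T.Gtp) (g g' : T.Gtp)
        (e : (T.cuspPairAt (T.tp T.PiXu) g).SplittingClass →
          (T.cuspPairAt (T.tp T.PiXu) g').SplittingClass),
      (∀ S' ∈ [T.tp T.PiXu, T.tp T.PiX, T.PiYddtp], S'.map Γ.toMulEquiv.toMonoidHom = S') →
      (T.cuspPairAt (T.tp T.PiXu) g).map Γ = T.cuspPairAt (T.tp T.PiXu) g' →
      (∀ (S₁ : Subgroup T.Gtp) (hS₁ : S₁ ∈ (T.cuspPairAt (T.tp T.PiXu) g).splittings),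
        ∃ h', e (GalSect.CuspPair.SplittingClass.mk _ S₁ hS₁) =
          GalSect.CuspPair.SplittingClass.mk _ (S₁.map Γ.toMulEquiv.toMonoidHom) h') →
      e '' RXu g = RXu g')
    (RCuu : ∀ g : T.Gtp, Set (T.cuspPairAt (T.tp T.PiCuu) g).SplittingClass)
    (hRCuu : ∀ g, (𝒟Cuu.torsor g).IsSubStructure (𝒟Cuu.mu (2 * l)) (𝒟Cuu.canonical g) (RCuu g))
    (hReqCuu : ∀ (Γ : T.Gtp ≃ₜ* T.Gtp) (g g' : T.Gtp)
        (e : (T.cuspPairAt (T.tp T.PiCuu) g).SplittingClass →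
          (T.cuspPairAt (T.tp T.PiCuu) g').SplittingClass),
      (∀ S' ∈ T.tower, S'.map Γ.toMulEquiv.toMonoidHom = S') →
      (T.cuspPairAt (T.tp T.PiCuu) g).map Γ = T.cuspPairAt (T.tp T.PiCuu) g' →
      (∀ (S₁ : Subgroup T.Gtp) (hS₁ : S₁ ∈ (T.cuspPairAt (T.tp T.PiCuu) g).splittings),
        ∃ h', e (GalSect.CuspPair.SplittingClass.mk _ S₁ hS₁) =
          GalSect.CuspPair.SplittingClass.mk _ (S₁.map Γ.toMulEquiv.toMonoidHom) h') →
      e '' RCuu g = RCuu g')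
    (RCu : ∀ g : T.Gtp, Set (T.cuspPairAt (T.tp T.PiCu) g).SplittingClass)
    (hRCu : ∀ g, (𝒟Cu.torsor g).IsSubStructure (𝒟Cu.mu 2) (𝒟Cu.canonical g) (RCu g))
    (hReqCu : ∀ (Γ : T.Gtp ≃ₜ* T.Gtp) (g g' : T.Gtp)
        (e : (T.cuspPairAt (T.tp T.PiCu) g).SplittingClass →
          (T.cuspPairAt (T.tp T.PiCu) g').SplittingClass),
      (∀ S' ∈ [T.tp T.PiCu, T.tp T.PiXu, T.tp T.PiX, T.PiYddtp],
        S'.map Γ.toMulEquiv.toMonoidHom = S') →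
      (T.cuspPairAt (T.tp T.PiCu) g).map Γ = T.cuspPairAt (T.tp T.PiCu) g' →
      (∀ (S₁ : Subgroup T.Gtp) (hS₁ : S₁ ∈ (T.cuspPairAt (T.tp T.PiCu) g).splittings),
        ∃ h', e (GalSect.CuspPair.SplittingClass.mk _ S₁ hS₁) =
          GalSect.CuspPair.SplittingClass.mk _ (S₁.map Γ.toMulEquiv.toMonoidHom) h') →
      e '' RCu g = RCu g') :
    Literature.AnabelianGeometry.EtaleTheta.ThetaCovers.TemperedCoverData.Cor28_ii T 𝒟Xuu 𝒟Xu 𝒟Cuu 𝒟Cu :=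
  T.cor28_ii_of_equivariantFamilies 𝒟Xuu 𝒟Xu 𝒟Cuu 𝒟Cu
    (fun Γ hΓ => by
      obtain ⟨hΔ, h, hDx⟩ := hstab Γ hΓ
      exact ⟨hΔ, h, T.cuspStabC_map_eq_of_tpDx Γ hDx⟩)
    RXuu hRXuu hReqXuu RXu hRXu hReqXu RCuu hRCuu hReqCuu RCu hRCu hReqCu

end TemperedCoverData

end ThetaCovers

end Literature.AnabelianGeometry.EtaleTheta

end
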